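import Literature.AlgebraicGeometry.Modules.DetClassOfIso
import Literature.AlgebraicGeometry.Modules.PullbackAffineChart
import HarnessLib

/-!
# Transport of rigidifications along squares of sections: generators and functoriality

Layer `Literature/AlgebraicGeometry/Modules`, namespace `Literature.AlgebraicGeometry.Modules`.
THEOREMS ONLY (no definition, no named fact, no instance).

Setting of [MumfordAV1970, §13 p. 125] / [BoschLutkebohmertRaynaud1990, §8.1] (rigidified line bundles and their base
change), at the generic scheme level: `e : T ⟶ X` a «section» (any morphism), `E` an `𝒪_X`-module RIGIDIFIED along
`e` by `r : e^*E ≅ 𝒪_T`.  For a commutative square `e' ≫ g = t ≫ e` (`g : X' ⟶ X`, `t : T' ⟶ T`, `e' : T' ⟶ X'`) the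
TRANSPORTED rigidification of `g^*E` along `e'` is the isomorphism
`e'^*g^*E ≅ (e' ≫ g)^*E ≅ (t ≫ e)^*E ≅ t^*e^*E ≅ t^*𝒪_T ≅ 𝒪_{T'}` (Mathlib `Scheme.Modules.pullbackComp`, `pullbackCongr`,
and an identification `υ : t^*𝒪_T ≅ 𝒪_{T'}` normalised by `υ⁻¹(1) = η_t(1)`, e.g. the inverse of ★ `pullbackUnitComparison t`);
this is the chain of ★ `AbelianSchemes.RigidifiedLineBundle.pullbackBase.rigid`.  A rigidification is determined by its
GENERATOR `r⁻¹(1) ∈ Γ(T, e^*E)` (§1: morphisms out of `𝒪` are determined by the image of `1`), and the point of this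
file is to COMPUTE the generator of a transported rigidification locally (§2) and deduce that transport is
FUNCTORIAL under composition of squares (§3) — the coherence input of the Zariski glueing of rigidified rank-one
families («the rigidified Picard functor is a Zariski sheaf on the base», [BoschLutkebohmertRaynaud1990, §8.1 Prop. 4]),
proved ELEMENTWISE on pulled-back local frames (★ `pullbackComp_hom_app_unitSection`, ★ `pullbackComp_inv_app_unitSection`,
★ `pullbackCongr_hom_app_unitSection`, ★ `pullback_map_app_unitSection`) and never as an identity between the
pseudofunctor isomorphisms themselves.

* §1 `unit_hom_ext_of_app_top_one`, `iso_unit_eq_of_inv_app_top_one` — `𝒪_T ⟶ M` is determined by the image of `1`;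
* §2 `transport_inv_app_top_one_restrict` — if `r⁻¹(1)|_{e⁻¹W} = c · η_e(b)` for a section `b ∈ Γ(E, W)`, then the
  transported generator restricted to `e'⁻¹g⁻¹W` is `t^♯(c) · η_{e'}(η_g(b))`;
* §3 `transport_comp` — for two squares `e₁ ≫ g₁ = t₁ ≫ e`, `e₂ ≫ g₂ = t₂ ≫ e₁` and `E` of rank one, transport along the
  composite square equals transport along the second square of the transport along the first (through
  `pullbackComp g₂ g₁`).

Everything is proved; no named facts.

## References
* [MumfordAV1970] D. Mumford, *Abelian Varieties* (1970), §13 (proof of the Thm. p. 125).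
* [BoschLutkebohmertRaynaud1990] S. Bosch, W. Lütkebohmert, M. Raynaud, *Néron Models* (1990), §8.1 Prop. 4.
* [MilneAV2008] J. S. Milne, *Abelian Varieties* (v2.00, 2008), I §8 pp. 36–37.
* [Hartshorne1977] R. Hartshorne, *Algebraic Geometry*, GTM 52 (1977), II.5 (p. 110).
-/

noncomputable section

-- `Scheme.Modules` / `SheafOfModules` are not reducible (as in Mathlib's `AlgebraicGeometry/Modules/Sheaf.lean`).
set_option backward.isDefEq.respectTransparency false

open CategoryTheory AlgebraicGeometry Opposite TopologicalSpace

universe u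

namespace Literature.AlgebraicGeometry.Modules

open Literature.AlgebraicGeometry.Motives

/-! ### §1 Morphisms out of `𝒪` are determined by the image of `1` -/

section UnitHomExt

variable {T : Scheme.{u}} {M : T.Modules}

/-- **A morphism `𝒪_T ⟶ M` is determined by the image of the global section `1`.** [cite: Hartshorne1977, II.5 (p. 109)] -/
theorem unit_hom_ext_of_app_top_one (φ ψ : unitModule T ⟶ M)
    (h : φ.app ⊤ (1 : Γ(T, ⊤)) = ψ.app ⊤ (1 : Γ(T, ⊤))) : φ = ψ := by
  refine Scheme.Modules.hom_ext _ _ fun U => ?_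
  ext (x : Γ(T, U))
  have hx : x = x • (unitModule T).presheaf.map (homOfLE (le_top : U ≤ ⊤)).op
      (1 : Γ(T, ⊤)) := by
    change x = x * T.presheaf.map (homOfLE (le_top : U ≤ ⊤)).op (1 : Γ(T, ⊤))
    rw [map_one, mul_one]
  rw [hx, Scheme.Modules.Hom.app_smul, Scheme.Modules.Hom.app_smul, Scheme.Modules.Hom.app_map_apply,
    Scheme.Modules.Hom.app_map_apply, h]

/-- **Two isomorphisms `M ≅ 𝒪_T` whose inverses send `1` to the same section are equal.** [cite: Hartshorne1977, II.5 (p. 109)] -/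
theorem iso_unit_eq_of_inv_app_top_one (A B : M ≅ unitModule T)
    (h : A.inv.app ⊤ (1 : Γ(T, ⊤)) = B.inv.app ⊤ (1 : Γ(T, ⊤))) : A = B := by
  have hinv : A.inv = B.inv := unit_hom_ext_of_app_top_one A.inv B.inv h
  ext : 1
  rw [← cancel_epi A.inv, A.inv_hom_id, hinv, B.inv_hom_id]

/-- Restricting a section of a module along `V ⟶ U` and back along any `U ⟶ V` is the identity (parallel inclusions
of opens coincide). [cite: Hartshorne1977, II.5 (p. 109)] -/
theorem presheaf_map_map_eq_self (N : T.Modules) {U V : T.Opens} (i : U ⟶ V) (j : V ⟶ U) (y : Γ(N, U)) :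
    N.presheaf.map i.op (N.presheaf.map j.op y) = y := by
  rw [← CategoryTheory.comp_apply, ← Functor.map_comp, ← op_comp, Subsingleton.elim (i ≫ j) (𝟙 _), op_id,
    CategoryTheory.Functor.map_id]
  rfl

end UnitHomExt

/-! ### §2 The generator of a transported rigidification, locally -/

section Transport

variable {X T X' T' : Scheme.{u}} (e : T ⟶ X) (g : X' ⟶ X) (t : T' ⟶ T) (e' : T' ⟶ X') (hsq : e' ≫ g = t ≫ e)
  (υ : (Scheme.Modules.pullback t).obj (SheafOfModules.unit T.ringCatSheaf) ≅ SheafOfModules.unit T'.ringCatSheaf)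
  (hυ : υ.inv.app ⊤ (1 : Γ(T', ⊤)) = unitSection t (SheafOfModules.unit T.ringCatSheaf) ⊤ (1 : Γ(T, ⊤)))

include hsq in
/-- The preimage opens of a square of sections: `e'⁻¹ g⁻¹ W = t⁻¹ e⁻¹ W`. [cite: MilneAV2008, I §8 pp. 36–37] -/
theorem preimage_preimage_eq_of_sectionSq (W : X.Opens) : e' ⁻¹ᵁ (g ⁻¹ᵁ W) = t ⁻¹ᵁ (e ⁻¹ᵁ W) := by
  rw [← Scheme.Hom.comp_preimage, ← Scheme.Hom.comp_preimage, hsq]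

include hυ in
/-- **The generator of a TRANSPORTED rigidification, locally.**  If the generator `r⁻¹(1)` of a rigidification
`r : e^*E ≅ 𝒪_T` reads `c · η_e(b)` over `e⁻¹W` for a section `b ∈ Γ(E, W)`, then the generator of the transported
rigidification `e'^*g^*E ≅ (e' ≫ g)^*E ≅ (t ≫ e)^*E ≅ t^*e^*E ≅ t^*𝒪_T ≅ 𝒪_{T'}` reads `t^♯(c) · η_{e'}(η_g(b))` over
`e'⁻¹g⁻¹W` (elementwise: ★ `pullback_map_app_unitSection`, ★ `pullbackComp_hom_app_unitSection`, ★
`pullbackCongr_hom_app_unitSection`, ★ `pullbackComp_inv_app_unitSection`). [cite: MumfordAV1970, §13 (p. 125)]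
[cite: Hartshorne1977, II.5 (p. 110)] -/
theorem transport_inv_app_top_one_restrict {E : X.Modules}
    (r : (Scheme.Modules.pullback e).obj E ≅ SheafOfModules.unit T.ringCatSheaf) {W : X.Opens} (c : Γ(T, e ⁻¹ᵁ W))
    (b : Γ(E, W))
    (hσ : ((Scheme.Modules.pullback e).obj E).presheaf.map (homOfLE (le_top : e ⁻¹ᵁ W ≤ ⊤)).op
        (r.inv.app ⊤ (1 : Γ(T, ⊤))) = c • unitSection e E W b) :
    ((Scheme.Modules.pullback e').obj ((Scheme.Modules.pullback g).obj E)).presheaf.map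
        (homOfLE (le_top : e' ⁻¹ᵁ (g ⁻¹ᵁ W) ≤ ⊤)).op
        (((Scheme.Modules.pullbackComp e' g).app E ≪≫ (Scheme.Modules.pullbackCongr hsq).app E ≪≫
            ((Scheme.Modules.pullbackComp t e).app E).symm ≪≫ (Scheme.Modules.pullback t).mapIso r ≪≫ υ).inv.app ⊤
          (1 : Γ(T', ⊤))) =
      T'.presheaf.map (eqToHom (preimage_preimage_eq_of_sectionSq e g t e' hsq W)).op (t.app (e ⁻¹ᵁ W) c) •
        unitSection e' ((Scheme.Modules.pullback g).obj E) (g ⁻¹ᵁ W) (unitSection g E W b) := by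
  -- `M₀ = e^*E` on `T`; on `T'`: `N = t^*M₀`, `M₁ = (t ≫ e)^*E`, `M₂ = (e' ≫ g)^*E`, `M' = e'^*g^*E`;
  -- `Φ := C₂ ≫ K⁻¹ ≫ C₁⁻¹ : N ⟶ M'` (the three pseudofunctor identifications, read backwards)
  have hO := preimage_preimage_eq_of_sectionSq e g t e' hsq W
  have hW : (t ≫ e) ⁻¹ᵁ W = (e' ≫ g) ⁻¹ᵁ W := by rw [hsq]
  -- step 1: `υ⁻¹(1) = η_t(1)` and `t^*r⁻¹ (η_t 1) = η_t (r⁻¹ 1)`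
  have h1 : (Scheme.Modules.Hom.app ((Scheme.Modules.pullback t).map r.inv) ⊤)
      ((Scheme.Modules.Hom.app υ.inv ⊤) (1 : Γ(T', ⊤))) =
      unitSection t ((Scheme.Modules.pullback e).obj E) ⊤ (r.inv.app ⊤ (1 : Γ(T, ⊤))) := by
    rw [hυ]
    exact pullback_map_app_unitSection t r.inv ⊤ (1 : Γ(T, ⊤))
  -- step 2: `η_t(r⁻¹ 1)|_{e'⁻¹g⁻¹W} = η_t((r⁻¹ 1)|_{e⁻¹W})` moved to `t⁻¹e⁻¹W`, then the local form of `r⁻¹ 1`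
  have h2 : ((Scheme.Modules.pullback t).obj ((Scheme.Modules.pullback e).obj E)).presheaf.map
      (homOfLE (le_top : e' ⁻¹ᵁ (g ⁻¹ᵁ W) ≤ ⊤)).op
      (unitSection t ((Scheme.Modules.pullback e).obj E) ⊤ (r.inv.app ⊤ (1 : Γ(T, ⊤)))) =
      ((Scheme.Modules.pullback t).obj ((Scheme.Modules.pullback e).obj E)).presheaf.map (eqToHom hO).op
        (t.app (e ⁻¹ᵁ W) c • unitSection t ((Scheme.Modules.pullback e).obj E) (e ⁻¹ᵁ W) (unitSection e E W b)) := by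
    rw [← unitSection_smul, ← hσ, unitSection_map, ← CategoryTheory.comp_apply, ← Functor.map_comp, ← op_comp]
    exact congrArg (fun i => ((Scheme.Modules.pullback t).obj ((Scheme.Modules.pullback e).obj E)).presheaf.map
      (Quiver.Hom.op i) (unitSection t ((Scheme.Modules.pullback e).obj E) ⊤ (r.inv.app ⊤ (1 : Γ(T, ⊤)))))
      (Subsingleton.elim _ _)
  -- step 3: `Φ` commutes with the transport `eqToHom hO` and is linear
  have h3 : Scheme.Modules.Hom.app (((Scheme.Modules.pullbackComp t e).hom.app E) ≫
        ((Scheme.Modules.pullbackCongr hsq).inv.app E) ≫ ((Scheme.Modules.pullbackComp e' g).inv.app E))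
        (e' ⁻¹ᵁ (g ⁻¹ᵁ W))
      (((Scheme.Modules.pullback t).obj ((Scheme.Modules.pullback e).obj E)).presheaf.map (eqToHom hO).op
        (t.app (e ⁻¹ᵁ W) c • unitSection t ((Scheme.Modules.pullback e).obj E) (e ⁻¹ᵁ W) (unitSection e E W b))) =
      T'.presheaf.map (eqToHom hO).op (t.app (e ⁻¹ᵁ W) c) •
        ((Scheme.Modules.pullback e').obj ((Scheme.Modules.pullback g).obj E)).presheaf.map (eqToHom hO).op
          (Scheme.Modules.Hom.app (((Scheme.Modules.pullbackComp t e).hom.app E) ≫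
              ((Scheme.Modules.pullbackCongr hsq).inv.app E) ≫ ((Scheme.Modules.pullbackComp e' g).inv.app E))
            (t ⁻¹ᵁ (e ⁻¹ᵁ W)) (unitSection t ((Scheme.Modules.pullback e).obj E) (e ⁻¹ᵁ W) (unitSection e E W b))) := by
    erw [Scheme.Modules.Hom.app_map_apply (((Scheme.Modules.pullbackComp t e).hom.app E) ≫
        ((Scheme.Modules.pullbackCongr hsq).inv.app E) ≫ ((Scheme.Modules.pullbackComp e' g).inv.app E)) (eqToHom hO),
      Scheme.Modules.Hom.app_smul, Scheme.Modules.map_smul]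
    rfl
  -- step 4: `Φ (η_t η_e b) = η_{e'} (η_g b)` (transported along `hW`)
  have h8 : (Scheme.Modules.Hom.app ((Scheme.Modules.pullbackCongr hsq).inv.app E) (t ⁻¹ᵁ (e ⁻¹ᵁ W)))
      (unitSection (t ≫ e) E W b) =
      ((Scheme.Modules.pullback (e' ≫ g)).obj E).presheaf.map (eqToHom hW).op (unitSection (e' ≫ g) E W b) :=
    pullbackCongr_hom_app_unitSection E hsq.symm W b
  have h9 : (Scheme.Modules.Hom.app ((Scheme.Modules.pullbackComp e' g).inv.app E) (t ⁻¹ᵁ (e ⁻¹ᵁ W)))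
      (((Scheme.Modules.pullback (e' ≫ g)).obj E).presheaf.map (eqToHom hW).op (unitSection (e' ≫ g) E W b)) =
      ((Scheme.Modules.pullback e').obj ((Scheme.Modules.pullback g).obj E)).presheaf.map (eqToHom hW).op
        (unitSection e' ((Scheme.Modules.pullback g).obj E) (g ⁻¹ᵁ W) (unitSection g E W b)) := by
    erw [Scheme.Modules.Hom.app_map_apply ((Scheme.Modules.pullbackComp e' g).inv.app E) (eqToHom hW)]
    exact congrArg _ (pullbackComp_inv_app_unitSection g E e' W b)
  have h4 : Scheme.Modules.Hom.app (((Scheme.Modules.pullbackComp t e).hom.app E) ≫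
        ((Scheme.Modules.pullbackCongr hsq).inv.app E) ≫ ((Scheme.Modules.pullbackComp e' g).inv.app E))
        (t ⁻¹ᵁ (e ⁻¹ᵁ W)) (unitSection t ((Scheme.Modules.pullback e).obj E) (e ⁻¹ᵁ W) (unitSection e E W b)) =
      ((Scheme.Modules.pullback e').obj ((Scheme.Modules.pullback g).obj E)).presheaf.map (eqToHom hW).op
        (unitSection e' ((Scheme.Modules.pullback g).obj E) (g ⁻¹ᵁ W) (unitSection g E W b)) := by
    rw [Scheme.Modules.Hom.comp_app, Scheme.Modules.Hom.comp_app, CategoryTheory.comp_apply, CategoryTheory.comp_apply,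
      pullbackComp_hom_app_unitSection e E t W b, h8, h9]
  -- assembly
  simp only [Iso.trans_inv, Iso.app_inv, Iso.symm_inv, Iso.app_hom, Functor.mapIso_inv, Scheme.Modules.Hom.comp_app,
    CategoryTheory.comp_apply]
  erw [h1, ← Scheme.Modules.Hom.app_map_apply ((Scheme.Modules.pullbackComp e' g).inv.app E)
      (homOfLE (le_top : e' ⁻¹ᵁ (g ⁻¹ᵁ W) ≤ ⊤)),
    ← Scheme.Modules.Hom.app_map_apply ((Scheme.Modules.pullbackCongr hsq).inv.app E)
      (homOfLE (le_top : e' ⁻¹ᵁ (g ⁻¹ᵁ W) ≤ ⊤)),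
    ← Scheme.Modules.Hom.app_map_apply ((Scheme.Modules.pullbackComp t e).hom.app E)
      (homOfLE (le_top : e' ⁻¹ᵁ (g ⁻¹ᵁ W) ≤ ⊤)), h2]
  simp only [Scheme.Modules.Hom.comp_app, CategoryTheory.comp_apply] at h3 h4
  erw [h3, h4]
  congr 1
  exact presheaf_map_map_eq_self _ (eqToHom hO) (eqToHom hW) _

/-- **The generator of a rigidification, locally**: for a rank-one `E`, around every point `y` of `T` the generator
`r⁻¹(1)` of `r : e^*E ≅ 𝒪_T` reads `c · η_e(b)` over `e⁻¹W` for a local frame section `b` of `E` near `e y`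
(the pulled-back frame, ★ `pullbackFrame`). [cite: Hartshorne1977, II.5 (p. 110)] -/
theorem exists_inv_app_top_one_restrict_eq_smul_unitSection {E : X.Modules} (h₁ : HasRank E 1)
    (r : (Scheme.Modules.pullback e).obj E ≅ SheafOfModules.unit T.ringCatSheaf) (y : T) :
    ∃ (W : X.Opens) (_ : e.base y ∈ W) (c : Γ(T, e ⁻¹ᵁ W)) (b : Γ(E, W)),
      ((Scheme.Modules.pullback e).obj E).presheaf.map (homOfLE (le_top : e ⁻¹ᵁ W ≤ ⊤)).op
        (r.inv.app ⊤ (1 : Γ(T, ⊤))) = c • unitSection e E W b := by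
  obtain ⟨F, hF⟩ := exists_frameSystem_of_hasRank h₁
  have hF' : ∀ z, (F.pullback e).rank z = 1 := fun z => hF _
  haveI : Fintype (F.I (e.base y)) := Fintype.ofEquiv _ (F.enum (e.base y)).symm
  refine ⟨F.U (e.base y), F.mem (e.base y), coord ((F.pullback e).frame y) (𝟙 _)
    (((Scheme.Modules.pullback e).obj E).presheaf.map (homOfLE (le_top : e ⁻¹ᵁ F.U (e.base y) ≤ ⊤)).op
      (r.inv.app ⊤ (1 : Γ(T, ⊤)))) ((F.pullback e).idx hF' y), basisSection (F.frame (e.base y)) ((F.pullback e).idx hF' y), ?_⟩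
  have key := (F.pullback e).eq_coord_smul_gen hF' (𝟙 _)
    (((Scheme.Modules.pullback e).obj E).presheaf.map (homOfLE (le_top : e ⁻¹ᵁ F.U (e.base y) ≤ ⊤)).op
      (r.inv.app ⊤ (1 : Γ(T, ⊤))))
  rw [presheaf_map_id] at key
  refine key.trans (congrArg _ ?_)
  exact basisSection_pullbackFrame e (F.frame (e.base y)) _

end Transport

/-! ### §3 Transport of rigidifications is functorial under composition of squares -/

section Comp

variable {X T X₁ T₁ X₂ T₂ : Scheme.{u}} (e : T ⟶ X) (g₁ : X₁ ⟶ X) (t₁ : T₁ ⟶ T) (e₁ : T₁ ⟶ X₁)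
  (hsq₁ : e₁ ≫ g₁ = t₁ ≫ e) (g₂ : X₂ ⟶ X₁) (t₂ : T₂ ⟶ T₁) (e₂ : T₂ ⟶ X₂) (hsq₂ : e₂ ≫ g₂ = t₂ ≫ e₁)
  (υ₁ : (Scheme.Modules.pullback t₁).obj (SheafOfModules.unit T.ringCatSheaf) ≅ SheafOfModules.unit T₁.ringCatSheaf)
  (hυ₁ : υ₁.inv.app ⊤ (1 : Γ(T₁, ⊤)) = unitSection t₁ (SheafOfModules.unit T.ringCatSheaf) ⊤ (1 : Γ(T, ⊤)))
  (υ₂ : (Scheme.Modules.pullback t₂).obj (SheafOfModules.unit T₁.ringCatSheaf) ≅ SheafOfModules.unit T₂.ringCatSheaf)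
  (hυ₂ : υ₂.inv.app ⊤ (1 : Γ(T₂, ⊤)) = unitSection t₂ (SheafOfModules.unit T₁.ringCatSheaf) ⊤ (1 : Γ(T₁, ⊤)))
  (υ₁₂ : (Scheme.Modules.pullback (t₂ ≫ t₁)).obj (SheafOfModules.unit T.ringCatSheaf) ≅ SheafOfModules.unit T₂.ringCatSheaf)
  (hυ₁₂ : υ₁₂.inv.app ⊤ (1 : Γ(T₂, ⊤)) = unitSection (t₂ ≫ t₁) (SheafOfModules.unit T.ringCatSheaf) ⊤ (1 : Γ(T, ⊤)))

include hsq₁ hsq₂ in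
/-- The composite of two squares of sections is a square of sections. [cite: MilneAV2008, I §8 pp. 36–37] -/
theorem sq_comp : e₂ ≫ (g₂ ≫ g₁) = (t₂ ≫ t₁) ≫ e := by
  rw [← Category.assoc, hsq₂, Category.assoc, hsq₁, Category.assoc]

include hυ₁ hυ₂ hυ₁₂ in
/-- **TRANSPORT OF RIGIDIFICATIONS IS FUNCTORIAL**: for squares of sections `e₁ ≫ g₁ = t₁ ≫ e` and `e₂ ≫ g₂ = t₂ ≫ e₁`
and a rank-one `E` rigidified by `r : e^*E ≅ 𝒪_T`, transporting `r` along the composite square equals transporting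
along the second square the transport along the first square, through Mathlib's `pullbackComp g₂ g₁`.  Proof: the two
isomorphisms `e₂^*(g₂ ≫ g₁)^*E ≅ 𝒪` have the same generator — locally both read `(t₂ ≫ t₁)^♯(c) · η_{e₂}(η_{g₂ ≫ g₁} b)` by
`transport_inv_app_top_one_restrict` (twice for the two-step route, ★ `pullbackComp_hom_app_unitSection` for the
comparison) — hence coincide (§1 and the sheaf property).  This is the coherence input of the Zariski glueing of
rigidified rank-one families. [cite: BoschLutkebohmertRaynaud1990, §8.1 Prop. 4] [cite: MumfordAV1970, §13 (p. 125)] -/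
theorem transport_comp {E : X.Modules} (h₁ : HasRank E 1)
    (r : (Scheme.Modules.pullback e).obj E ≅ SheafOfModules.unit T.ringCatSheaf) :
    ((Scheme.Modules.pullbackComp e₂ (g₂ ≫ g₁)).app E ≪≫
        (Scheme.Modules.pullbackCongr (sq_comp e g₁ t₁ e₁ hsq₁ g₂ t₂ e₂ hsq₂)).app E ≪≫
          ((Scheme.Modules.pullbackComp (t₂ ≫ t₁) e).app E).symm ≪≫ (Scheme.Modules.pullback (t₂ ≫ t₁)).mapIso r ≪≫ υ₁₂) =
      (Scheme.Modules.pullback e₂).mapIso ((Scheme.Modules.pullbackComp g₂ g₁).app E).symm ≪≫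
        ((Scheme.Modules.pullbackComp e₂ g₂).app _ ≪≫ (Scheme.Modules.pullbackCongr hsq₂).app _ ≪≫
          ((Scheme.Modules.pullbackComp t₂ e₁).app _).symm ≪≫
            (Scheme.Modules.pullback t₂).mapIso
              ((Scheme.Modules.pullbackComp e₁ g₁).app E ≪≫ (Scheme.Modules.pullbackCongr hsq₁).app E ≪≫
                ((Scheme.Modules.pullbackComp t₁ e).app E).symm ≪≫ (Scheme.Modules.pullback t₁).mapIso r ≪≫ υ₁) ≪≫ υ₂) := by
  apply iso_unit_eq_of_inv_app_top_one
  -- compare the two generators locally on `T₂`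
  have hloc := fun q : T₂ =>
    exists_inv_app_top_one_restrict_eq_smul_unitSection e h₁ r (t₁.base (t₂.base q))
  choose W hW c b hσ using hloc
  refine TopCat.Sheaf.eq_of_locally_eq'
    (⟨((Scheme.Modules.pullback e₂).obj ((Scheme.Modules.pullback (g₂ ≫ g₁)).obj E)).presheaf,
      Scheme.Modules.isSheaf _⟩ : TopCat.Sheaf Ab T₂)
    (fun q : T₂ => e₂ ⁻¹ᵁ ((g₂ ≫ g₁) ⁻¹ᵁ W q)) ⊤ (fun q => homOfLE le_top) (fun q _ => ?_) _ _ fun q => ?_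
  · refine Opens.mem_iSup.mpr ⟨q, ?_⟩
    change (e₂ ≫ g₂ ≫ g₁) q ∈ W q
    rw [sq_comp e g₁ t₁ e₁ hsq₁ g₂ t₂ e₂ hsq₂, Scheme.Hom.comp_apply, Scheme.Hom.comp_apply]
    exact hW q
  -- route 1 (composite square)
  have A := transport_inv_app_top_one_restrict e (g₂ ≫ g₁) (t₂ ≫ t₁) e₂ (sq_comp e g₁ t₁ e₁ hsq₁ g₂ t₂ e₂ hsq₂)
    υ₁₂ hυ₁₂ r (c q) (b q) (hσ q)
  -- route 2 (first square, then second square on `g₁^*E` with the section `η_{g₁} b`)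
  have B₁ := transport_inv_app_top_one_restrict e g₁ t₁ e₁ hsq₁ υ₁ hυ₁ r (c q) (b q) (hσ q)
  have B₂ := transport_inv_app_top_one_restrict e₁ g₂ t₂ e₂ hsq₂ υ₂ hυ₂
    ((Scheme.Modules.pullbackComp e₁ g₁).app E ≪≫ (Scheme.Modules.pullbackCongr hsq₁).app E ≪≫
      ((Scheme.Modules.pullbackComp t₁ e).app E).symm ≪≫ (Scheme.Modules.pullback t₁).mapIso r ≪≫ υ₁) _ _ B₁
  change _ = ((Scheme.Modules.pullback e₂).obj ((Scheme.Modules.pullback (g₂ ≫ g₁)).obj E)).presheaf.map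
    (homOfLE le_top).op
    ((Scheme.Modules.Hom.app ((Scheme.Modules.pullback e₂).map ((Scheme.Modules.pullbackComp g₂ g₁).app E).hom) ⊤) _)
  erw [A, ← Scheme.Modules.Hom.app_map_apply
    ((Scheme.Modules.pullback e₂).map ((Scheme.Modules.pullbackComp g₂ g₁).app E).hom) (homOfLE le_top), B₂,
    Scheme.Modules.Hom.app_smul, pullback_map_app_unitSection, pullbackComp_hom_app_unitSection g₁ E g₂ (W q) (b q)]
  congr 1
  -- the two scalars are `(t₂ ≫ t₁)^♯(c)` moved to `e₂⁻¹ (g₂ ≫ g₁)⁻¹ W`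
  change ((t₂ ≫ t₁).app (e ⁻¹ᵁ W q) ≫ T₂.presheaf.map (eqToHom _).op) (c q) =
    ((t₁.app (e ⁻¹ᵁ W q) ≫ T₁.presheaf.map (eqToHom _).op) ≫ t₂.app _ ≫ T₂.presheaf.map (eqToHom _).op) (c q)
  have k₁ : ∀ {U V : T₂.Opens} (i j : U ⟶ V), T₂.presheaf.map i.op = T₂.presheaf.map j.op :=
    fun i j => by rw [Subsingleton.elim i j]
  have k₂ : ∀ {U V : T₁.Opens} (i j : U ⟶ V), T₁.presheaf.map i.op = T₁.presheaf.map j.op :=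
    fun i j => by rw [Subsingleton.elim i j]
  rw [k₁ (eqToHom _) (homOfLE (eqToHom (preimage_preimage_eq_of_sectionSq e (g₂ ≫ g₁) (t₂ ≫ t₁) e₂
      (sq_comp e g₁ t₁ e₁ hsq₁ g₂ t₂ e₂ hsq₂) (W q))).le),
    k₂ (eqToHom _) (homOfLE (eqToHom (preimage_preimage_eq_of_sectionSq e g₁ t₁ e₁ hsq₁ (W q))).le),
    k₁ (eqToHom (preimage_preimage_eq_of_sectionSq e₁ g₂ t₂ e₂ hsq₂ (g₁ ⁻¹ᵁ W q)))
      (homOfLE (eqToHom (preimage_preimage_eq_of_sectionSq e₁ g₂ t₂ e₂ hsq₂ (g₁ ⁻¹ᵁ W q))).le)]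
  change ((t₂ ≫ t₁).appLE (e ⁻¹ᵁ W q) _ _) (c q) = (t₁.appLE (e ⁻¹ᵁ W q) _ _ ≫ t₂.appLE _ _ _) (c q)
  rw [Scheme.Hom.appLE_comp_appLE]

end Comp

end Literature.AlgebraicGeometry.Modules

end
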